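import Mathlib

/-!
# Route `KPlusLogSqLaw`, crux `TropicalB` — WIDTH-TWO walk systems: the value difference is an ITERATED CLAMP; an iterated clamp
# is the ENVELOPE CLAMP on an intersecting window and FROZEN (memoryless) past a broken one; the non-frozen parameter set is an interval

HONEST FRAMING.  Helper file (seat val-sym-trop-p1 g5, cell `pub-symmetroid`, 2026-08-27) toward the registered stubs of
`Cruxes/TropicalB/Lines/birth.lean` (crux `TropicalB`, item `stmt-ValiantsHypothesis-19771`), on the WALK-DESIGN route of the `K = 4`
growth fork (D2): after Gusfield's width-explicit bound `(2W)^⌈log₂ T⌉` (`…TropicalBWalkGusfield`, p490642) the cell's question of record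
(HANDOFF «val-sym-trop-p1 (g4)», lead R1714 (E)) is whether BOUNDED-width walk systems carry more than linearly many dominant terms in
the number `T` of layers.  This is the pointwise structure theory of the smallest case `W = 2`; nothing here is about `TropicalB` in
its window, `WeakLifting`, the doors, `MatrixDescartes` (`stmt-ValiantsHypothesis-18050`) or VP ≠ VNP.  Elementary real arithmetic
([folklore]-level); the point is the STATEMENTS, used by the seat's memo HOME/val-sym-trop-p1/g5/WALK-WIDTH-g5.md.

A width-two layered walk system at a fixed parameter value is the two-state max-plus recurrence `F^A_{t+1} = max (F^A_t + α_t)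
(F^B_t + β_t)`, `F^B_{t+1} = max (F^A_t + γ_t) (F^B_t + δ_t)` (`stepA`, `stepB`; heaviest-walk convention of the tree's dominance
designs; `α, β, γ, δ` = the four arc weights of layer `t` AT this parameter value; every statement below is about plain reals).
* §1 `clamp lo hi x = max lo (min x hi)` and its COMPOSITION LAW `clamp_clamp` (a clamp of a clamp is the clamp to the clamped interval).
* §2 `diff_step_of_par` / `_of_cross`: the difference `D = F^B − F^A` moves by `D' = clamp (γ−α) (δ−β) (D + (δ−α))` when
  `γ − δ ≤ α − β` («parallel» layer), by `D' = clamp (δ−β) (γ−α) (−D + (γ−β))` otherwise; `stepA_eq` / `stepB_eq`: the levels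
  accumulate the overshoots `(D − (α−β))⁺`, `((γ−δ) − D)⁺`.
* §3 iterated clamps `iterClamp l h s n`, running envelopes `runMax`, `runMin`; **`iterClamp_eq_clamp_of_window`** (window with a
  common point ⇒ the composed map IS the clamp to `[max l, min h]`), **`iterClamp_frozen_low` / `_high`**, `iterClamp_indep_of_broken`
  (a step breaking the later window ⇒ the composed map is CONSTANT = an envelope value), `iterClamp_mem`, `break_low_or_high`.
* §4 `diff_eq_iterClamp_of_par`: along parallel layers `D_n − C_n = iterClamp` of the shifted barriers (`C` = cumulative shift);
  `diff_eq_clamp_of_window`; **`diff_indep_of_broken`**: past a broken window the value difference forgets the initial values.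
* §5 `convexOn_runMax` / `concaveOn_runMin` / **`convex_openSet`**: with barriers convex / concave in the parameter (e.g. affine),
  the parameter set on which a window is strictly intersecting — the non-frozen set — is an INTERVAL.

WHY (located; the memo has the details).  Arc weights are affine in `θ`, so `θ ↦ D_T(θ)` is piecewise a clamp of `D_0` into a
WINDOWED ENVELOPE band (convex lower / concave upper edge, window start monotone away from the centre); off the window's interval the
two value functions differ by a locally affine function and SHARE their breakpoints («twins»).  Paper consequences: `#breakpoints(D_T)
= O(T)` for every width-two system; `#breakpoint locations of F^A_T ∪ F^B_T = O(T)` iff twin creations are `O(T)` — the one open point.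
Exact hull counts (py/hullwalk.py): adversarial `W = 2`, `T ≤ 16`: `≈ 3T + O(1)` vertices; random `W ≤ 8`, `T ≤ 800`: `c(W)·T`.
-/

set_option linter.dupNamespace false -- the mandated D-0017 path `…ValiantsHypothesis.ValiantsHypothesis…` repeats a component
set_option autoImplicit false

namespace Summit.ValiantsHypothesis.ValiantsHypothesis.Theorems.KPlusLogSqLaw
namespace WidthTwo

/-! ## §1. Clamps -/

/-- `clamp lo hi x = max lo (min x hi)`: for `lo ≤ hi` the median of `lo, x, hi` (the nearest point of `[lo, hi]` to `x`). [folklore] -/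
def clamp (lo hi x : ℝ) : ℝ := max lo (min x hi)

/-- below the interval the clamp is its lower end. [folklore] -/
theorem clamp_of_le_lo {lo hi x : ℝ} (hx : x ≤ lo) : clamp lo hi x = lo := by
  unfold clamp
  exact max_eq_left ((min_le_left _ _).trans hx)

/-- above the interval the clamp is its upper end. [folklore] -/
theorem clamp_of_hi_le {lo hi x : ℝ} (hlh : lo ≤ hi) (hx : hi ≤ x) : clamp lo hi x = hi := by
  unfold clamp
  rw [min_eq_right hx, max_eq_right hlh]

/-- inside the interval the clamp is the identity. [folklore] -/
theorem clamp_of_mem {lo hi x : ℝ} (h1 : lo ≤ x) (h2 : x ≤ hi) : clamp lo hi x = x := by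
  unfold clamp
  rw [min_eq_left h2, max_eq_right h1]

/-- the clamp is at least the lower end. [folklore] -/
theorem lo_le_clamp (lo hi x : ℝ) : lo ≤ clamp lo hi x := le_max_left _ _

/-- the clamp is at most the upper end (when `lo ≤ hi`). [folklore] -/
theorem clamp_le_hi {lo hi : ℝ} (hlh : lo ≤ hi) (x : ℝ) : clamp lo hi x ≤ hi :=
  max_le hlh (min_le_right _ _)

/-- translating everything translates the clamp. [folklore] -/
theorem clamp_sub (lo hi x c : ℝ) : clamp lo hi x - c = clamp (lo - c) (hi - c) (x - c) := by
  unfold clamp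
  simp only [max_def, min_def]
  split_ifs <;> linarith

/-- **Composition law.**  A clamp of a clamp is the clamp to the clamped interval:
`clamp lo₂ hi₂ ∘ clamp lo₁ hi₁ = clamp (clamp lo₂ hi₂ lo₁) (clamp lo₂ hi₂ hi₁)` (for `lo₁ ≤ hi₁`, `lo₂ ≤ hi₂`). [folklore] -/
theorem clamp_clamp {lo₁ hi₁ lo₂ hi₂ : ℝ} (h₁ : lo₁ ≤ hi₁) (h₂ : lo₂ ≤ hi₂) (x : ℝ) :
    clamp lo₂ hi₂ (clamp lo₁ hi₁ x) = clamp (clamp lo₂ hi₂ lo₁) (clamp lo₂ hi₂ hi₁) x := by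
  unfold clamp
  simp only [max_def, min_def]
  split_ifs <;> linarith

/-! ## §2. One layer of a width-two walk system: the value difference moves by a clamp -/

/-- value at state `A` after one layer: `max (F^A + α) (F^B + β)` (`α` = arc `A → A`, `β` = arc `B → A`). [folklore] -/
def stepA (α β FA FB : ℝ) : ℝ := max (FA + α) (FB + β)

/-- value at state `B` after one layer: `max (F^A + γ) (F^B + δ)` (`γ` = arc `A → B`, `δ` = arc `B → B`). [folklore] -/
def stepB (γ δ FA FB : ℝ) : ℝ := max (FA + γ) (FB + δ)

/-- the `A`-level accumulates the OVERSHOOT of the difference `D = F^B − F^A` above the decision level `α − β`. [folklore] -/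
theorem stepA_eq (α β FA FB : ℝ) : stepA α β FA FB = FA + α + max 0 (FB - FA - (α - β)) := by
  unfold stepA
  simp only [max_def]
  split_ifs <;> linarith

/-- the `B`-level accumulates the UNDERSHOOT of `D` below the decision level `γ − δ`. [folklore] -/
theorem stepB_eq (γ δ FA FB : ℝ) : stepB γ δ FA FB = FB + δ + max 0 ((γ - δ) - (FB - FA)) := by
  unfold stepB
  simp only [max_def]
  split_ifs <;> linarith

/-- **Clamp law, parallel side.**  If `γ − δ ≤ α − β` then the new difference is
`clamp (γ − α) (δ − β) (D + (δ − α))`: the old difference, shifted, clamped between the «both from A» and the «both from B»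
values. [folklore] -/
theorem diff_step_of_par {α β γ δ : ℝ} (hpar : γ - δ ≤ α - β) (FA FB : ℝ) :
    stepB γ δ FA FB - stepA α β FA FB = clamp (γ - α) (δ - β) ((FB - FA) + (δ - α)) := by
  unfold stepA stepB clamp
  simp only [max_def, min_def]
  split_ifs <;> linarith

/-- **Clamp law, crossed side.**  If `α − β ≤ γ − δ` then the new difference is `clamp (δ − β) (γ − α) (−D + (γ − β))`
(reflected, shifted, clamped). [folklore] -/
theorem diff_step_of_cross {α β γ δ : ℝ} (hcr : α - β ≤ γ - δ) (FA FB : ℝ) :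
    stepB γ δ FA FB - stepA α β FA FB = clamp (δ - β) (γ - α) (-(FB - FA) + (γ - β)) := by
  unfold stepA stepB clamp
  simp only [max_def, min_def]
  split_ifs <;> linarith

/-! ## §3. Iterated clamps: envelope clamp on an intersecting window, frozen past a broken one -/

section Iter

variable (l h : ℕ → ℝ)
/-- `iterClamp l h s n x`: apply the clamps of steps `s, s+1, …, s+n−1` (barriers `l u`, `h u`) to `x`. [folklore] -/
def iterClamp (s : ℕ) : ℕ → ℝ → ℝ
  | 0, x => x
  | n + 1, x => clamp (l (s + n)) (h (s + n)) (iterClamp s n x)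

/-- running maximum of the lower barriers on the window `[s, s+k]`. [folklore] -/
def runMax (s : ℕ) : ℕ → ℝ
  | 0 => l s
  | k + 1 => max (runMax s k) (l (s + (k + 1)))

/-- running minimum of the upper barriers on the window `[s, s+k]`. [folklore] -/
def runMin (s : ℕ) : ℕ → ℝ
  | 0 => h s
  | k + 1 => min (runMin s k) (h (s + (k + 1)))

/-- no step: the identity. [folklore] -/
@[simp] theorem iterClamp_zero (s : ℕ) (x : ℝ) : iterClamp l h s 0 x = x := rfl
/-- one more step: one more clamp. [folklore] -/
theorem iterClamp_succ (s n : ℕ) (x : ℝ) :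
    iterClamp l h s (n + 1) x = clamp (l (s + n)) (h (s + n)) (iterClamp l h s n x) := rfl

/-- splitting a run of clamps. [folklore] -/
theorem iterClamp_add (s n n' : ℕ) (x : ℝ) :
    iterClamp l h s (n + n') x = iterClamp l h (s + n) n' (iterClamp l h s n x) := by
  induction n' with
  | zero => rfl
  | succ n' ih =>
    rw [← Nat.add_assoc, iterClamp_succ, ih, iterClamp_succ, Nat.add_assoc]

/-- the value after a run of clamps is the start value or one of the barrier values met. [folklore] -/
theorem iterClamp_mem (s n : ℕ) (x : ℝ) :
    iterClamp l h s n x = x ∨ ∃ u, s ≤ u ∧ u < s + n ∧ (iterClamp l h s n x = l u ∨ iterClamp l h s n x = h u) := by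
  induction n with
  | zero => exact Or.inl rfl
  | succ n ih =>
    rw [iterClamp_succ]
    set y := iterClamp l h s n x with hy
    by_cases h1 : y ≤ l (s + n)
    · rw [clamp_of_le_lo h1]
      exact Or.inr ⟨s + n, by omega, by omega, Or.inl rfl⟩
    · push Not at h1
      by_cases h2 : y ≤ h (s + n)
      · rw [clamp_of_mem h1.le h2]
        rcases ih with h3 | ⟨u, hu1, hu2, hu3⟩
        · exact Or.inl h3
        · exact Or.inr ⟨u, hu1, by omega, hu3⟩
      · push Not at h2
        unfold clamp
        rw [min_eq_right h2.le]
        rcases le_total (l (s + n)) (h (s + n)) with h3 | h3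
        · rw [max_eq_right h3]
          exact Or.inr ⟨s + n, by omega, by omega, Or.inr rfl⟩
        · rw [max_eq_left h3]
          exact Or.inr ⟨s + n, by omega, by omega, Or.inl rfl⟩

/-- the running maximum grows with the window. [folklore] -/
theorem runMax_le_succ (s k : ℕ) : runMax l s k ≤ runMax l s (k + 1) := le_max_left _ _

/-- the running minimum shrinks with the window. [folklore] -/
theorem runMin_succ_le (s k : ℕ) : runMin h s (k + 1) ≤ runMin h s k := min_le_left _ _

/-- every lower barrier of the window is below the running maximum. [folklore] -/
theorem le_runMax (s : ℕ) : ∀ {i k : ℕ}, i ≤ k → l (s + i) ≤ runMax l s k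
  | i, 0, hik => by obtain rfl : i = 0 := Nat.le_zero.mp hik; exact le_rfl
  | i, k + 1, hik => by
    rcases Nat.lt_or_eq_of_le hik with h1 | rfl
    · exact (le_runMax s (Nat.lt_succ_iff.mp h1)).trans (le_max_left _ _)
    · exact le_max_right _ _

/-- every upper barrier of the window is above the running minimum. [folklore] -/
theorem runMin_le (s : ℕ) : ∀ {i k : ℕ}, i ≤ k → runMin h s k ≤ h (s + i)
  | i, 0, hik => by obtain rfl : i = 0 := Nat.le_zero.mp hik; exact le_rfl
  | i, k + 1, hik => by
    rcases Nat.lt_or_eq_of_le hik with h1 | rfl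
    · exact (min_le_left _ _).trans (runMin_le s (Nat.lt_succ_iff.mp h1))
    · exact min_le_right _ _

/-- the running maximum is below any common upper bound of the window's lower barriers. [folklore] -/
theorem runMax_le_of_forall (s k : ℕ) (c : ℝ) (hc : ∀ i ≤ k, l (s + i) ≤ c) : runMax l s k ≤ c := by
  induction k with
  | zero => simpa [runMax] using hc 0 le_rfl
  | succ k ih =>
    simp only [runMax, max_le_iff]
    exact ⟨ih (fun i hi => hc i (Nat.le_succ_of_le hi)), hc (k + 1) le_rfl⟩

/-- the running minimum is above any common lower bound of the window's upper barriers. [folklore] -/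
theorem le_runMin_of_forall (s k : ℕ) (c : ℝ) (hc : ∀ j ≤ k, c ≤ h (s + j)) : c ≤ runMin h s k := by
  induction k with
  | zero => simpa [runMin] using hc 0 le_rfl
  | succ k ih =>
    simp only [runMin, le_min_iff]
    exact ⟨ih (fun j hj => hc j (Nat.le_succ_of_le hj)), hc (k + 1) le_rfl⟩

/-- the window `[s, s+k]` is INTERSECTING (`runMax ≤ runMin`) iff its intervals pairwise meet (Helly on the line). [folklore] -/
theorem runMax_le_runMin_iff (s k : ℕ) :
    runMax l s k ≤ runMin h s k ↔ ∀ i ≤ k, ∀ j ≤ k, l (s + i) ≤ h (s + j) := by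
  constructor
  · intro hw i hi j hj
    exact (le_runMax l s hi).trans (hw.trans (runMin_le h s hj))
  · intro hp
    exact runMax_le_of_forall l s k _ (fun i hi => le_runMin_of_forall h s k _ (fun j hj => hp i hi j hj))

/-- **ENVELOPE CLAMP ON AN INTERSECTING WINDOW.**  If the intervals of steps `s, …, s+k` have a common point
(`runMax l s k ≤ runMin h s k`) then the composed map of these `k+1` clamps is the single clamp to `[max l, min h]`. [folklore] -/
theorem iterClamp_eq_clamp_of_window (s : ℕ) :
    ∀ k : ℕ, runMax l s k ≤ runMin h s k → ∀ x : ℝ,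
      iterClamp l h s (k + 1) x = clamp (runMax l s k) (runMin h s k) x := by
  intro k
  induction k with
  | zero => intro _ x; rfl
  | succ k ih =>
    intro hw x
    have hw' : runMax l s k ≤ runMin h s k := (runMax_le_succ l s k).trans (hw.trans (runMin_succ_le h s k))
    have hl' : l (s + (k + 1)) ≤ runMin h s (k + 1) := (le_max_right _ _).trans hw
    have hh' : runMax l s (k + 1) ≤ h (s + (k + 1)) := hw.trans (min_le_right _ _)
    have hlh : l (s + (k + 1)) ≤ h (s + (k + 1)) := hl'.trans (runMin_le h s le_rfl)
    rw [iterClamp_succ, ih hw' x, clamp_clamp hw' hlh]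
    congr 1
    · unfold clamp
      rw [min_eq_left ((runMax_le_succ l s k).trans hh'), max_comm]
      rfl
    · unfold clamp
      exact max_eq_right hl'

/-- **FROZEN PAST A BROKEN WINDOW (break from below).**  If the window of steps `s+j+1, …, s+j+1+k` is intersecting but the
interval of step `s+j` lies BELOW its envelope interval, the composed map from step `s` is CONSTANT `= runMax l (s+j+1) k`. [folklore] -/
theorem iterClamp_frozen_low (s j k : ℕ) (hw : runMax l (s + j + 1) k ≤ runMin h (s + j + 1) k)
    (hlh : l (s + j) ≤ h (s + j)) (hbr : h (s + j) < runMax l (s + j + 1) k) (x : ℝ) :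
    iterClamp l h s (j + 1 + (k + 1)) x = runMax l (s + j + 1) k := by
  rw [iterClamp_add, show s + (j + 1) = s + j + 1 from rfl, iterClamp_eq_clamp_of_window l h (s + j + 1) k hw]
  apply clamp_of_le_lo
  rw [iterClamp_succ]
  exact (clamp_le_hi hlh _).trans hbr.le

/-- **FROZEN PAST A BROKEN WINDOW (break from above)**: symmetrically the composed map is constant `= runMin h (s+j+1) k`. [folklore] -/
theorem iterClamp_frozen_high (s j k : ℕ) (hw : runMax l (s + j + 1) k ≤ runMin h (s + j + 1) k)
    (hbr : runMin h (s + j + 1) k < l (s + j)) (x : ℝ) :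
    iterClamp l h s (j + 1 + (k + 1)) x = runMin h (s + j + 1) k := by
  rw [iterClamp_add, show s + (j + 1) = s + j + 1 from rfl, iterClamp_eq_clamp_of_window l h (s + j + 1) k hw]
  apply clamp_of_hi_le hw
  rw [iterClamp_succ]
  exact hbr.le.trans (lo_le_clamp _ _ _)

/-- **Memory loss.**  Under either break the value after the run does not depend on the value before it. [folklore] -/
theorem iterClamp_indep_of_broken (s j k : ℕ) (hw : runMax l (s + j + 1) k ≤ runMin h (s + j + 1) k)
    (hlh : l (s + j) ≤ h (s + j))
    (hbr : h (s + j) < runMax l (s + j + 1) k ∨ runMin h (s + j + 1) k < l (s + j)) (x y : ℝ) :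
    iterClamp l h s (j + 1 + (k + 1)) x = iterClamp l h s (j + 1 + (k + 1)) y := by
  rcases hbr with hbr | hbr
  · rw [iterClamp_frozen_low l h s j k hw hlh hbr, iterClamp_frozen_low l h s j k hw hlh hbr]
  · rw [iterClamp_frozen_high l h s j k hw hbr, iterClamp_frozen_high l h s j k hw hbr]

end Iter

/-! ## §4. Width-two walk systems: along a run of parallel-type layers the value difference is an iterated clamp -/

section Walk

/-- cumulative shift `C t = Σ_{u<t} (δ u − α u)` of a run of parallel-type layers. [folklore] -/
def cumShift (α δ : ℕ → ℝ) : ℕ → ℝ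
  | 0 => 0
  | t + 1 => cumShift α δ t + (δ t - α t)

/-- shifted lower barrier of layer `u`: `(γ u − α u) − C (u+1)`. [folklore] -/
def loBar (α γ δ : ℕ → ℝ) (u : ℕ) : ℝ := γ u - α u - cumShift α δ (u + 1)

/-- shifted upper barrier of layer `u`: `(δ u − β u) − C (u+1)`. [folklore] -/
def hiBar (α β δ : ℕ → ℝ) (u : ℕ) : ℝ := δ u - β u - cumShift α δ (u + 1)

variable (α β γ δ FA FB : ℕ → ℝ)

/-- on a parallel-type layer the shifted barriers are ordered. [folklore] -/
theorem loBar_le_hiBar {α β γ δ : ℕ → ℝ} {u : ℕ} (hpar : γ u - δ u ≤ α u - β u) :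
    loBar α γ δ u ≤ hiBar α β δ u := by
  unfold loBar hiBar; linarith

/-- **The value difference is an iterated clamp.**  If `(F^A, F^B)` solves the two-state recurrence and the layers
`0, …, n−1` are of parallel type (`γ − δ ≤ α − β`), then `F^B_n − F^A_n − C_n` is the `n`-fold clamp of `F^B_0 − F^A_0` by the
shifted barriers. [folklore] -/
theorem diff_eq_iterClamp_of_par (hA : ∀ t, FA (t + 1) = stepA (α t) (β t) (FA t) (FB t))
    (hB : ∀ t, FB (t + 1) = stepB (γ t) (δ t) (FA t) (FB t)) :
    ∀ n : ℕ, (∀ t < n, γ t - δ t ≤ α t - β t) →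
      FB n - FA n - cumShift α δ n = iterClamp (loBar α γ δ) (hiBar α β δ) 0 n (FB 0 - FA 0) := by
  intro n
  induction n with
  | zero => intro _; simp [cumShift]
  | succ n ih =>
    intro hpar
    have ih' := ih (fun t ht => hpar t (Nat.lt_succ_of_lt ht))
    rw [iterClamp_succ, ← ih', hA n, hB n, diff_step_of_par (hpar n (Nat.lt_succ_self n)), Nat.zero_add]
    show clamp (γ n - α n) (δ n - β n) (FB n - FA n + (δ n - α n)) - cumShift α δ (n + 1) = _
    rw [clamp_sub]
    unfold loBar hiBar
    congr 1
    simp only [cumShift]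
    ring

/-- **Envelope form.**  If moreover the shifted window `[0, k]` is intersecting, the value difference after `k+1` layers is the
cumulative shift plus the clamp of the initial difference to the envelope band. [folklore] -/
theorem diff_eq_clamp_of_window (hA : ∀ t, FA (t + 1) = stepA (α t) (β t) (FA t) (FB t))
    (hB : ∀ t, FB (t + 1) = stepB (γ t) (δ t) (FA t) (FB t)) (k : ℕ)
    (hpar : ∀ t < k + 1, γ t - δ t ≤ α t - β t)
    (hw : runMax (loBar α γ δ) 0 k ≤ runMin (hiBar α β δ) 0 k) :
    FB (k + 1) - FA (k + 1) =
      cumShift α δ (k + 1) + clamp (runMax (loBar α γ δ) 0 k) (runMin (hiBar α β δ) 0 k) (FB 0 - FA 0) := by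
  have h1 := diff_eq_iterClamp_of_par α β γ δ FA FB hA hB (k + 1) hpar
  rw [iterClamp_eq_clamp_of_window _ _ 0 k hw] at h1
  linarith

/-- **Memory loss of width-two walk systems.**  Two solutions of the SAME recurrence (same arcs) whose layers `0, …, j+k+1`
are of parallel type, with the shifted window of layers `j+1, …, j+1+k` intersecting and broken by layer `j`, have the SAME
value difference after layer `j+1+k` — whatever their initial values.  (At a parameter value where this happens the two value
functions of the system differ by the same amount for every initialisation: the «twin» mechanism of the seat's memo.) [folklore] -/
theorem diff_indep_of_broken (FA' FB' : ℕ → ℝ)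
    (hA : ∀ t, FA (t + 1) = stepA (α t) (β t) (FA t) (FB t)) (hB : ∀ t, FB (t + 1) = stepB (γ t) (δ t) (FA t) (FB t))
    (hA' : ∀ t, FA' (t + 1) = stepA (α t) (β t) (FA' t) (FB' t)) (hB' : ∀ t, FB' (t + 1) = stepB (γ t) (δ t) (FA' t) (FB' t))
    (j k : ℕ) (hpar : ∀ t < j + 1 + (k + 1), γ t - δ t ≤ α t - β t)
    (hw : runMax (loBar α γ δ) (j + 1) k ≤ runMin (hiBar α β δ) (j + 1) k)
    (hbr : hiBar α β δ j < runMax (loBar α γ δ) (j + 1) k ∨ runMin (hiBar α β δ) (j + 1) k < loBar α γ δ j) :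
    FB (j + 1 + (k + 1)) - FA (j + 1 + (k + 1)) = FB' (j + 1 + (k + 1)) - FA' (j + 1 + (k + 1)) := by
  have h1 := diff_eq_iterClamp_of_par α β γ δ FA FB hA hB _ hpar
  have h2 := diff_eq_iterClamp_of_par α β γ δ FA' FB' hA' hB' _ hpar
  have hlh : loBar α γ δ (0 + j) ≤ hiBar α β δ (0 + j) := by
    rw [Nat.zero_add]; exact loBar_le_hiBar (hpar j (by omega))
  have hw0 : runMax (loBar α γ δ) (0 + j + 1) k ≤ runMin (hiBar α β δ) (0 + j + 1) k := by rwa [Nat.zero_add]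
  have hbr0 : hiBar α β δ (0 + j) < runMax (loBar α γ δ) (0 + j + 1) k ∨
      runMin (hiBar α β δ) (0 + j + 1) k < loBar α γ δ (0 + j) := by rwa [Nat.zero_add]
  have h3 := iterClamp_indep_of_broken (loBar α γ δ) (hiBar α β δ) 0 j k hw0 hlh hbr0 (FB 0 - FA 0) (FB' 0 - FA' 0)
  linarith

end Walk

/-! ## §5. In the parameter: envelopes of convex / concave barrier families, and the OPEN SET IS AN INTERVAL -/

section Param

variable (L H : ℕ → ℝ → ℝ)

/-- the running maximum of CONVEX barrier functions (e.g. affine in the parameter) is convex in the parameter. [folklore] -/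
theorem convexOn_runMax (hL : ∀ u, ConvexOn ℝ Set.univ (L u)) (s : ℕ) :
    ∀ k, ConvexOn ℝ Set.univ (fun θ => runMax (fun u => L u θ) s k) := by
  intro k
  induction k with
  | zero => exact hL s
  | succ k ih => exact ih.sup (hL (s + (k + 1)))

/-- the running minimum of CONCAVE barrier functions is concave in the parameter. [folklore] -/
theorem concaveOn_runMin (hH : ∀ u, ConcaveOn ℝ Set.univ (H u)) (s : ℕ) :
    ∀ k, ConcaveOn ℝ Set.univ (fun θ => runMin (fun u => H u θ) s k) := by
  intro k
  induction k with
  | zero => exact hH s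
  | succ k ih => exact ih.inf (hH (s + (k + 1)))

/-- **The non-frozen parameter set of a window is an interval**: the set of parameters at which the window `[s, s+k]` is
STRICTLY intersecting (`runMax < runMin`) is convex.  (With §3: off an interval the composed map of the window is memoryless, and
on it it is the clamp into the band between a convex and a concave function — the «windowed envelope» picture.) [folklore] -/
theorem convex_openSet (hL : ∀ u, ConvexOn ℝ Set.univ (L u)) (hH : ∀ u, ConcaveOn ℝ Set.univ (H u)) (s k : ℕ) :
    Convex ℝ {θ : ℝ | runMax (fun u => L u θ) s k < runMin (fun u => H u θ) s k} := by
  have h1 := (convexOn_runMax L hL s k).sub (concaveOn_runMin H hH s k)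
  have h2 := h1.convex_lt 0
  have hset : {θ : ℝ | runMax (fun u => L u θ) s k < runMin (fun u => H u θ) s k} =
      {x ∈ (Set.univ : Set ℝ) |
        ((fun θ => runMax (fun u => L u θ) s k) - fun θ => runMin (fun u => H u θ) s k) x < 0} := by
    ext θ
    simp only [Set.mem_setOf_eq, Set.mem_univ, true_and, Pi.sub_apply, sub_lt_zero]
  rw [hset]
  exact h2

end Param

end WidthTwo
end Summit.ValiantsHypothesis.ValiantsHypothesis.Theorems.KPlusLogSqLaw
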